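import Mathlib
import Summits.ValiantsHypothesis.ValiantsHypothesis.Theorems.BinomialElusiveBinomialMapsElusiveExactOrders

/-!
# Crux `BinomialElusive.BinomialMapsElusive` (stmt-ValiantsHypothesis-7393) — no DEEP-TORIC local
# swallowers

Local (formal) setting of the crux at the place over `x = 0` (the tree's `numericToPuiseux_proof`
turns a containment of the binomial curve in `Γ(ℂ^{m-1})` into such data): series `p_j` in a
Hahn-series field `K = HahnSeries Δ R` (`R` a field of characteristic `0`), and for each coordinate
`i` a binomial identity

  `α_i p^{A_i} + β_i p^{B_i} = t^{e_i} + t^{e_i + g_i}`      (`g_i > 0` pairwise distinct).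

Call coordinate `i` DEEP-TORIC if its second monomial is invisible to relative precision `g_i`:
`β_i p^{B_i} = 0` or `ord(β_i p^{B_i}) > e_i + g_i` (the toric case `β_i = 0` of the route's proved
support `ToricBinomialElusive`, and the "deep honest" case `d_i > g_i` of the structure note
`Cruxes/BinomialMapsElusive/STRUCTURE-p1.md`).  **Theorem `card_le_of_deepToric`: if every
coordinate is deep-toric then `#coordinates ≤ #variables`.**  Hence a binomial map from fewer
variables than coordinates that swallows the curve formally must have a SHALLOW (`d_i ≤ g_i`), tied
or cancelling coordinate — the "unit-correction" regime of the route text, which is where the crux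
(and its sibling `PeelingLemma`) lives.

Proof: write `p_j = c_j t^{ν_j} w_j` with `w_j` a principal unit (`decompose`); a deep-toric identity
forces `ord(α_i p^{A_i}) = e_i`, leading coefficient `1`, hence `w^{A_i} + r_i = 1 + t^{g_i}` with
`ord r_i > g_i`; the exact-order lemma (`card_le_of_monomial_add_eq_one_add_single`, file
`BinomialElusiveBinomialMapsElusiveExactOrders`) bounds the number of such `i` by the number of `j`.
Mathlib + that file only.
-/

-- layout Summits/ValiantsHypothesis/ValiantsHypothesis forces the duplicated namespace component
set_option linter.dupNamespace false

namespace Summit.ValiantsHypothesis.ValiantsHypothesis.Theorems.BinomialMapsElusiveDeepToric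

open scoped BigOperators
open Finset
open Summit.ValiantsHypothesis.ValiantsHypothesis.Theorems.BinomialMapsElusiveExactOrders

variable {Δ : Type*} [AddCommGroup Δ] [LinearOrder Δ] [IsOrderedAddMonoid Δ]
  {R : Type*} [Field R]

omit [IsOrderedAddMonoid Δ] in
/-- A series with vanishing coefficients in all orders `≤ 0` has `ord > 0`. -/
theorem orderTop_pos_of_coeff {x : HahnSeries Δ R} (h : ∀ d ≤ 0, x.coeff d = 0) :
    0 < x.orderTop := by
  refine lt_of_le_of_ne ?_ (HahnSeries.orderTop_ne_of_coeff_eq_zero (h 0 le_rfl)).symm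
  exact HahnSeries.le_orderTop_iff_forall.mpr fun j hj => h j (le_of_lt (WithTop.coe_lt_coe.mp hj))

/-- **Monomial × principal unit decomposition.**  A nonzero series is `single ν c * w` with
`ν` its order, `c ≠ 0` its leading coefficient and `w` a principal unit (`ord(w - 1) > 0`). -/
theorem decompose {x : HahnSeries Δ R} (hx : x ≠ 0) :
    x = HahnSeries.single x.order x.leadingCoeff *
        ((HahnSeries.single (-x.order) x.leadingCoeff⁻¹) * x) ∧
      0 < ((HahnSeries.single (-x.order) x.leadingCoeff⁻¹) * x - 1).orderTop := by
  have hc : x.leadingCoeff ≠ 0 := HahnSeries.leadingCoeff_ne_zero.mpr hx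
  constructor
  · rw [← mul_assoc, HahnSeries.single_mul_single, add_neg_cancel, mul_inv_cancel₀ hc]
    rw [HahnSeries.single_zero_one]  -- `single 0 1 = 1`
    rw [one_mul]
  · refine orderTop_pos_of_coeff fun d hd => ?_
    rw [HahnSeries.coeff_sub, HahnSeries.coeff_single_mul]
    rcases eq_or_lt_of_le hd with rfl | hd'
    · rw [sub_neg_eq_add, zero_add, HahnSeries.coeff_one, if_pos rfl,
        ← HahnSeries.leadingCoeff_eq, inv_mul_cancel₀ hc, sub_self]
    · rw [HahnSeries.coeff_one, if_neg (ne_of_lt hd'), sub_zero,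
        HahnSeries.coeff_eq_zero_of_lt_order (by simpa using hd'), mul_zero]

/-- The target binomial `t^e + t^{e+g}` (`g > 0`): order `e`, coefficient `1` at `e`. -/
theorem orderTop_target {e g : Δ} (hg : 0 < g) :
    (HahnSeries.single e (1 : R) + HahnSeries.single (e + g) 1).orderTop = ((e : Δ) : WithTop Δ) := by
  have h : (HahnSeries.single e (1 : R)).orderTop < (HahnSeries.single (e + g) (1 : R)).orderTop := by
    rw [HahnSeries.orderTop_single one_ne_zero, HahnSeries.orderTop_single one_ne_zero,
      WithTop.coe_lt_coe]
    exact lt_add_of_pos_right e hg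
  rw [HahnSeries.orderTop_add_eq_left h, HahnSeries.orderTop_single one_ne_zero]

variable [CharZero R]

/-- **No deep-toric local swallower.**  Series `p_j` (`j ∈ σ`) and binomial identities
`α_i p^{A_i} + β_i p^{B_i} = t^{e_i} + t^{e_i + g_i}` (`i ∈ ι`) with pairwise distinct positive gaps
`g_i`, in which every second monomial is deep (`β_i p^{B_i} = 0` or of order `> e_i + g_i`), force
`|ι| ≤ |σ|`. -/
theorem card_le_of_deepToric {σ ι : Type*} [Fintype σ] [Fintype ι]
    (p : σ → HahnSeries Δ R) (A B : ι → σ → ℕ) (α β : ι → R) (e g : ι → Δ)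
    (hg0 : ∀ i, 0 < g i) (hg : Function.Injective g)
    (hsol : ∀ i, α i • ∏ j, p j ^ A i j + β i • ∏ j, p j ^ B i j =
      HahnSeries.single (e i) 1 + HahnSeries.single (e i + g i) 1)
    (hdeep : ∀ i, β i • ∏ j, p j ^ B i j = 0 ∨
      ((e i + g i : Δ) : WithTop Δ) < (β i • ∏ j, p j ^ B i j).orderTop) :
    Fintype.card ι ≤ Fintype.card σ := by
  classical
  -- notation
  set T : ι → HahnSeries Δ R := fun i => HahnSeries.single (e i) 1 + HahnSeries.single (e i + g i) 1
    with hT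
  set U : ι → HahnSeries Δ R := fun i => α i • ∏ j, p j ^ A i j with hU
  set V : ι → HahnSeries Δ R := fun i => β i • ∏ j, p j ^ B i j with hV
  have hT_ord : ∀ i, (T i).orderTop = e i := fun i => orderTop_target (hg0 i)
  have hV_ord : ∀ i, ((e i : Δ) : WithTop Δ) < (V i).orderTop := fun i => by
    rcases hdeep i with h | h
    · rw [show V i = 0 from h, HahnSeries.orderTop_zero]; exact WithTop.coe_lt_top _
    · exact lt_trans (WithTop.coe_lt_coe.mpr (lt_add_of_pos_right _ (hg0 i))) h
  have hUeq : ∀ i, U i = T i + -V i := fun i => by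
    rw [← sub_eq_add_neg, eq_sub_iff_add_eq]; exact hsol i
  have hU_ord : ∀ i, (U i).orderTop = e i := fun i => by
    rw [hUeq, HahnSeries.orderTop_add_eq_left (by rw [hT_ord, HahnSeries.orderTop_neg]; exact hV_ord i),
      hT_ord]
  have hU_ne : ∀ i, U i ≠ 0 := fun i h => by
    have := hU_ord i; rw [h, HahnSeries.orderTop_zero] at this; exact WithTop.top_ne_coe this
  have hU_coeff : ∀ i, (U i).coeff (e i) = 1 := fun i => by
    rw [hUeq, HahnSeries.coeff_add, HahnSeries.coeff_neg,
      HahnSeries.coeff_eq_zero_of_lt_orderTop (hV_ord i), neg_zero, add_zero, hT,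
      HahnSeries.coeff_add, HahnSeries.coeff_single_same, HahnSeries.coeff_single_of_ne, add_zero]
    exact ne_of_lt (lt_add_of_pos_right _ (hg0 i))
  -- every variable occurring in some `A_i` is nonzero; decompose all nonzero `p_j`
  have hp_ne : ∀ i j, A i j ≠ 0 → p j ≠ 0 := fun i j hA hpj => by
    apply hU_ne i
    simp only [hU]
    rw [Finset.prod_eq_zero (Finset.mem_univ j) (by rw [hpj, zero_pow hA]), smul_zero]
  set ν : σ → Δ := fun j => (p j).order with hν
  set c : σ → R := fun j => if p j = 0 then 1 else (p j).leadingCoeff with hc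
  set w : σ → HahnSeries Δ R := fun j =>
    if p j = 0 then 1 else HahnSeries.single (-(p j).order) (p j).leadingCoeff⁻¹ * p j with hw
  have hw_pr : ∀ j, 0 < (w j - 1).orderTop := fun j => by
    by_cases hpj : p j = 0
    · simp [hw, hpj]
    · simp only [hw, if_neg hpj]; exact (decompose hpj).2
  have hpw : ∀ j, p j ≠ 0 → p j = HahnSeries.single (ν j) (c j) * w j := fun j hpj => by
    simp only [hν, hc, hw, if_neg hpj]; exact (decompose hpj).1
  have hc_ne : ∀ j, c j ≠ 0 := fun j => by
    by_cases hpj : p j = 0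
    · simp [hc, hpj]
    · simp only [hc, if_neg hpj]; exact HahnSeries.leadingCoeff_ne_zero.mpr hpj
  -- the monomial `p^{A_i}` splits as `single ⟨A_i, ν⟩ (c^{A_i}) * w^{A_i}`
  have hmono : ∀ i, ∏ j, p j ^ A i j =
      HahnSeries.single (∑ j, A i j • ν j) (∏ j, c j ^ A i j) * ∏ j, w j ^ A i j := fun i => by
    have h1 : ∀ j, p j ^ A i j = HahnSeries.single (A i j • ν j) (c j ^ A i j) * w j ^ A i j := by
      intro j
      by_cases hA : A i j = 0
      · simp [hA]
      · rw [hpw j (hp_ne i j hA), mul_pow, HahnSeries.single_pow]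
    simp_rw [h1]
    rw [Finset.prod_mul_distrib]
    congr 1
    induction (Finset.univ : Finset σ) using Finset.induction_on with
    | empty => simp
    | insert a s ha ih => rw [Finset.prod_insert ha, Finset.sum_insert ha, Finset.prod_insert ha, ih,
        HahnSeries.single_mul_single]
  -- compare with `U_i = T_i - V_i`: exponent `e_i`, coefficient `1`
  set W : ι → HahnSeries Δ R := fun i => ∏ j, w j ^ A i j with hW
  set κ : ι → R := fun i => α i * ∏ j, c j ^ A i j with hκ
  set E : ι → Δ := fun i => ∑ j, A i j • ν j with hE
  have hW_pr : ∀ i, 0 < (W i - 1).orderTop := fun i =>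
    (lt_orderTop_prod_sub_one Finset.univ (fun j => w j ^ A i j)
      (fun j _ => principal_pow (hw_pr j) _) WithTop.zero_ne_top
      (fun j _ => principal_pow (hw_pr j) _)).1
  have hUW : ∀ i, U i = HahnSeries.single (E i) (κ i) * W i := fun i => by
    simp only [hU, hW, hκ, hE]
    rw [hmono i, ← HahnSeries.C_mul_eq_smul, ← mul_assoc, HahnSeries.C_apply,
      HahnSeries.single_mul_single, zero_add]
  have hκ_ne : ∀ i, κ i ≠ 0 := fun i => by
    simp only [hκ]
    refine mul_ne_zero ?_ (Finset.prod_ne_zero_iff.mpr fun j _ => pow_ne_zero _ (hc_ne j))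
    intro hα; apply hU_ne i; simp [hU, hα]
  have hE_eq : ∀ i, E i = e i := fun i => by
    have h := hU_ord i
    rw [hUW, HahnSeries.orderTop_mul, HahnSeries.orderTop_single (hκ_ne i),
      orderTop_eq_zero_of_principal (hW_pr i), add_zero] at h
    exact WithTop.coe_injective h
  have hκ_eq : ∀ i, κ i = 1 := fun i => by
    have h := hU_coeff i
    rw [hUW, ← hE_eq i, HahnSeries.coeff_single_mul, sub_self] at h
    -- `coeff 0 (W i) = 1`
    have hW0 : (W i).coeff 0 = 1 := by
      have h0 : (W i - 1).coeff 0 = 0 := HahnSeries.coeff_eq_zero_of_lt_orderTop (hW_pr i)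
      rw [HahnSeries.coeff_sub, HahnSeries.coeff_one, if_pos rfl, sub_eq_zero] at h0
      exact h0
    rw [hW0, mul_one] at h
    exact h
  -- the exact-order lemma applies to `W_i + r_i = 1 + t^{g_i}`, `r_i := t^{-e_i} V_i`
  refine card_le_of_monomial_add_eq_one_add_single w hw_pr (fun i j => (A i j : ℤ)) g hg
    (fun i => HahnSeries.single (-e i) (1 : R) * V i) (fun i => ?_) (fun i => ?_)
  · -- depth: `ord(t^{-e_i} V_i) > g_i`
    rcases hdeep i with h | h
    · rw [show V i = 0 from h, mul_zero, HahnSeries.orderTop_zero]; exact WithTop.coe_lt_top _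
    · rw [show β i • ∏ j, p j ^ B i j = V i from rfl] at h
      by_cases hVne : V i = 0
      · rw [hVne, mul_zero, HahnSeries.orderTop_zero]; exact WithTop.coe_lt_top _
      rw [HahnSeries.orderTop_mul, HahnSeries.orderTop_single one_ne_zero]
      obtain ⟨v, hv⟩ := WithTop.ne_top_iff_exists.mp (HahnSeries.orderTop_ne_top.mpr hVne)
      rw [← hv, WithTop.coe_lt_coe] at h
      rw [← hv, ← WithTop.coe_add, WithTop.coe_lt_coe]
      exact lt_neg_add_iff_add_lt.mpr h
  · -- the identity: `W_i + t^{-e_i} V_i = 1 + t^{g_i}`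
    simp only [zpow_natCast]
    have h1 : W i = HahnSeries.single (-e i) (1 : R) * U i := by
      rw [hUW, hκ_eq, hE_eq, ← mul_assoc, HahnSeries.single_mul_single, neg_add_cancel, mul_one,
        HahnSeries.single_zero_one, one_mul]
    rw [show (∏ j, w j ^ A i j) = W i from rfl, h1, ← mul_add, show U i + V i = T i from hsol i, hT]
    simp only [mul_add, HahnSeries.single_mul_single, one_mul, neg_add_cancel, neg_add_cancel_left,
      HahnSeries.single_zero_one]

omit [CharZero R] in
/-- `aeval` of a monomial at formal Laurent series (with the `R`-algebra structure Mathlib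
synthesises on `LaurentSeries R`, through `PowerSeries R`): `α • Π_j p_j ^ A_j`. -/
theorem aeval_monomial_eq_smul_prod {s : ℕ} (p : Fin s → LaurentSeries R) (A : Fin s →₀ ℕ) (α : R) :
    MvPolynomial.aeval p (MvPolynomial.monomial A α) = α • ∏ j, p j ^ A j := by
  rw [MvPolynomial.aeval_monomial, Finsupp.prod_fintype _ _ (fun j => by simp),
    HahnSeries.algebraMap_apply']
  simp

/-- **No deep-toric local swallower, crux vocabulary** (`MvPolynomial` over `Fin s`, Laurent-type
targets `t^{N a_i} + t^{N b_i}` as produced by `numericToPuiseux_proof`): if `Γ_i = α_i y^{A_i} +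
β_i y^{B_i}` with `Γ_i(p) = t^{N a_i} + t^{N b_i}` (`a_i < b_i`, gaps `b_i - a_i` pairwise distinct,
`N > 0`) and every second monomial is deep (`β_i p^{B_i} = 0` or of order `> N b_i`), then `m ≤ s`.
So for `s < m` some coordinate is shallow, tied or cancelling (after renaming `A_i ↔ B_i`). -/
theorem le_of_deepToric_aeval {s m : ℕ} (Γ : Fin m → MvPolynomial (Fin s) R)
    (A B : Fin m → Fin s →₀ ℕ) (α β : Fin m → R)
    (hΓ : ∀ i, Γ i = MvPolynomial.monomial (A i) (α i) + MvPolynomial.monomial (B i) (β i))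
    (N : ℕ) (hN : 0 < N) (a b : Fin m → ℕ) (hab : ∀ i, a i < b i)
    (hgap : Function.Injective fun i => b i - a i) (p : Fin s → LaurentSeries R)
    (hsol : ∀ i, MvPolynomial.aeval p (Γ i) =
      HahnSeries.single ((N * a i : ℕ) : ℤ) 1 + HahnSeries.single ((N * b i : ℕ) : ℤ) 1)
    (hdeep : ∀ i, MvPolynomial.aeval p (MvPolynomial.monomial (B i) (β i)) = 0 ∨
      (((N * b i : ℕ) : ℤ) : WithTop ℤ) <
        (MvPolynomial.aeval p (MvPolynomial.monomial (B i) (β i))).orderTop) :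
    m ≤ s := by
  have hg0 : ∀ i, (0 : ℤ) < ((N * b i : ℕ) : ℤ) - ((N * a i : ℕ) : ℤ) := fun i => by
    have : N * a i < N * b i := Nat.mul_lt_mul_of_pos_left (hab i) hN
    omega
  have hg : Function.Injective fun i => ((N * b i : ℕ) : ℤ) - ((N * a i : ℕ) : ℤ) := by
    intro i j hij
    apply hgap
    have hi := hab i; have hj := hab j
    simp only at hij
    have h1 : ((N : ℤ) * ((b i : ℤ) - a i)) = (N : ℤ) * ((b j : ℤ) - a j) := by push_cast at hij; linarith
    have h2 : ((b i : ℤ) - a i) = ((b j : ℤ) - a j) :=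
      mul_left_cancel₀ (by exact_mod_cast hN.ne') h1
    zify [hi.le, hj.le]
    exact h2
  have key := card_le_of_deepToric (σ := Fin s) (ι := Fin m) p (fun i j => A i j) (fun i j => B i j)
    α β (fun i => ((N * a i : ℕ) : ℤ)) (fun i => ((N * b i : ℕ) : ℤ) - ((N * a i : ℕ) : ℤ)) hg0 hg
    (fun i => by
      rw [← aeval_monomial_eq_smul_prod, ← aeval_monomial_eq_smul_prod, ← map_add, ← hΓ, hsol i,
        add_sub_cancel])
    (fun i => by
      rw [← aeval_monomial_eq_smul_prod, add_sub_cancel]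
      exact hdeep i)
  simpa using key

end Summit.ValiantsHypothesis.ValiantsHypothesis.Theorems.BinomialMapsElusiveDeepToric
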